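import Literature.AlgebraicGeometry.ShimuraVarieties.HeckeCorrespondenceAction
import Mathlib.Topology.Algebra.ConstMulAction
import Mathlib.Topology.Covering.Quotient

/-!
# Local continuous slice sections of the uniformization `cone → X(ℂ)` of a ball quotient
# (crux `EndoscopicMiddleDegree.OrthogonalEnveloped`, stmt-HodgeConjecture-14300; `--supports`;
# line `purity-sorted-hecke-envelope` / `HeckeGraphChow`, sub-stub A1 of S2b, seat c3)

For a ball-quotient datum `D : UnitaryBallQuotientDatum p X` (`X(ℂ) ≅ Γ \ 𝔹`, `𝔹 = D.ball = D.cone / ℂˣ`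
the ball of negative lines, `D.unif : ℂ^{p+1} → X(ℂ)` the uniformization, `D.ballUnif : 𝔹 → X(ℂ)` the
induced open quotient map with the `Γ`-orbits as fibres) such that `Γ` acts freely
(`IsCancelSMul`) and properly discontinuously on the locally compact Hausdorff ball, we PROVE the
registered sub-stub `stub_unifSliceSection`: through every `P ∈ X(ℂ)` there is a local CONTINUOUS
section `σ : U → ℂ^{p+1}` of `unif`, with values in the affine slice `{v | v i = 1}` of an open
`V ⊆ D.cone` on whose slice `unif` is injective.

Proof. `ballUnif` is the quotient covering map of the `Γ`-action
(`IsQuotientMap.isQuotientCoveringMap_of_properlyDiscontinuousSMul`), so a point `b₀` over `P` has an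
open neighbourhood `W` (a sheet) meeting each `Γ`-orbit at most once, i.e. on which `ballUnif` is
injective (`exists_isOpen_injOn_ballUnif`). Choose a cone vector `v₀` spanning `b₀` and a coordinate
`i` with `v₀ i ≠ 0` (cone vectors are non-zero). The saturated open set
`V = {v ∈ cone | [v] ∈ W, v i ≠ 0}` is stable under the normalisation `nrm v = v / v i`, `unif` is
injective on the slice `T = {v ∈ V | v i = 1}` (two slice vectors with the same image span lines of the
sheet with the same image, hence the same line, and agree at `i`), `U = unif(T) = unif(V)` is open
(`unif` is open on the cone), and the set-theoretic inverse `σ = (unif|T)⁻¹` is continuous on `U`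
because `U ∩ σ⁻¹(A) = unif(V ∩ nrm⁻¹(A))` is open for every open `A` (`nrm` is continuous off
`{v i = 0}`).

References: A. Hatcher, *Algebraic Topology*, §1.3 (Prop. 1.40: quotient maps of free properly
discontinuous actions are covering maps); BMM arXiv:1306.1515 = Acta Math. 216 (2016), Part 2 §1.4.
-/

noncomputable section

-- The crux-workfile namespace `Summit.<P>.<Sub>.Cruxes.…` repeats `HodgeConjecture` (single-conjunct summit).
set_option linter.dupNamespace false

namespace Summit.HodgeConjecture.HodgeConjecture.Cruxes.OrthogonalEnveloped.HeckeGraphChow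

open scoped Topology
open Literature.AlgebraicGeometry.Motives (SchemeOver ComplexPoints)
open Literature.AlgebraicGeometry.ShimuraVarieties
open MulAction

namespace UnifSliceSection

variable {p : ℕ} {X : SchemeOver ℂ} (D : UnitaryBallQuotientDatum p X)

/-! ### Normalising a vector by one of its coordinates: `v ↦ v / vᵢ` -/

/-- `(v / vᵢ)ᵢ = 1`. [folklore] -/
theorem nrm_apply_self {i : Fin (p + 1)} {v : Fin (p + 1) → ℂ} (h : v i ≠ 0) :
    ((v i)⁻¹ • v) i = 1 := by
  simp [h]

/-- A slice vector is its own normalisation. [folklore] -/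
theorem nrm_of_apply_eq_one {i : Fin (p + 1)} {v : Fin (p + 1) → ℂ} (h : v i = 1) :
    (v i)⁻¹ • v = v := by
  rw [h, inv_one, one_smul]

/-- The normalisation is continuous off the hyperplane `{v i = 0}`. [folklore] -/
theorem continuousOn_nrm (i : Fin (p + 1)) :
    ContinuousOn (fun v : Fin (p + 1) → ℂ ↦ (v i)⁻¹ • v) {v | v i ≠ 0} := by
  have h1 : ContinuousOn (fun v : Fin (p + 1) → ℂ ↦ (v i)⁻¹) {v | v i ≠ 0} :=
    (continuous_apply i).continuousOn.inv₀ fun _ hv ↦ hv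
  exact h1.smul continuousOn_id

/-- The normalisation of a cone vector lies in the cone (the cone is a union of punctured lines).
[cite: BergeronMillsonMoeglin2016Balls, Part 2 §1.3] -/
theorem nrm_mem_cone {i : Fin (p + 1)} {v : Fin (p + 1) → ℂ} (hv : v ∈ D.cone) (h : v i ≠ 0) :
    (v i)⁻¹ • v ∈ D.cone :=
  smul_mem_negCone (inv_ne_zero h) hv

/-- `unif (v / vᵢ) = unif v`: the uniformization is constant on punctured lines.
[cite: BergeronMillsonMoeglin2016Balls, Part 2 §1.3] -/
theorem unif_nrm {i : Fin (p + 1)} {v : Fin (p + 1) → ℂ} (hv : v ∈ D.cone) (h : v i ≠ 0) :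
    D.unif ((v i)⁻¹ • v) = D.unif v :=
  D.unif_smul (inv_ne_zero h) hv

/-- `[c • v] = [v]` in the ball, for `c ≠ 0`. [folklore] -/
theorem toBall_mk_smul {c : ℂ} (hc : c ≠ 0) {v : Fin (p + 1) → ℂ} (hv : v ∈ D.cone)
    (hcv : c • v ∈ D.cone) : D.toBall ⟨c • v, hcv⟩ = D.toBall ⟨v, hv⟩ :=
  (D.toBall_eq_toBall_iff _ _).2 ⟨Units.mk0 c hc, Subtype.ext rfl⟩

/-- A cone vector has a non-zero coordinate (`⟪0, 0⟫ = 0` is not negative). [folklore] -/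
theorem exists_apply_ne_zero {v : Fin (p + 1) → ℂ} (hv : v ∈ D.cone) : ∃ i, v i ≠ 0 := by
  have hne : v ≠ 0 := by
    rintro rfl
    have hv' := mem_negCone_iff.1 hv
    rw [Matrix.mulVec_zero, dotProduct_zero, Complex.zero_re] at hv'
    exact lt_irrefl 0 hv'
  obtain ⟨i, h⟩ := Function.ne_iff.1 hne
  exact ⟨i, h⟩

/-! ### Open subsets of the cone, sheets, and the slice section -/

/-- The image under `unif` of an open subset of `ℂ^{p+1}` contained in the cone is open in `X(ℂ)`
(`unif` is open on the cone). [cite: BergeronMillsonMoeglin2016Balls, Introduction §1.1] -/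
theorem isOpen_image_unif {S : Set (Fin (p + 1) → ℂ)} (hS : IsOpen S) (hSc : S ⊆ D.cone) :
    IsOpen (D.unif '' S) := by
  have : D.unif '' S = D.cone.restrict D.unif '' (Subtype.val ⁻¹' S) := by
    ext P
    constructor
    · rintro ⟨v, hv, rfl⟩
      exact ⟨⟨v, hSc hv⟩, hv, rfl⟩
    · rintro ⟨v, hv, rfl⟩
      exact ⟨v, hv, rfl⟩
  rw [this]
  exact D.isOpenMap_unif _ (hS.preimage continuous_subtype_val)

/-- The **saturated cone over an open subset `W` of the ball, off the hyperplane `{v i = 0}`** — the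
cone vectors spanning a line of `W` and with non-zero `i`-th coordinate — is open in `ℂ^{p+1}` (the
cone is open and `cone → ball` is continuous). [folklore] -/
theorem isOpen_saturation (i : Fin (p + 1)) {W : Set D.ball} (hW : IsOpen W) :
    IsOpen {v : Fin (p + 1) → ℂ | ∃ hv : v ∈ D.cone, D.toBall ⟨v, hv⟩ ∈ W ∧ v i ≠ 0} := by
  have hS : IsOpen (D.toBall ⁻¹' W ∩ {w : D.cone | (w : Fin (p + 1) → ℂ) i ≠ 0}) :=
    (hW.preimage continuous_quotient_mk').inter
      (isOpen_ne_fun ((continuous_apply i).comp continuous_subtype_val) continuous_const)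
  have : {v : Fin (p + 1) → ℂ | ∃ hv : v ∈ D.cone, D.toBall ⟨v, hv⟩ ∈ W ∧ v i ≠ 0} =
      Subtype.val '' (D.toBall ⁻¹' W ∩ {w : D.cone | (w : Fin (p + 1) → ℂ) i ≠ 0}) := by
    ext v
    constructor
    · rintro ⟨hv, hvW, hvi⟩
      exact ⟨⟨v, hv⟩, ⟨hvW, hvi⟩, rfl⟩
    · rintro ⟨w, ⟨hwW, hwi⟩, rfl⟩
      exact ⟨w.2, hwW, hwi⟩
  rw [this]
  exact (isOpen_negCone _).isOpenMap_subtype_val _ hS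

/-- The saturated cone over `W` off `{v i = 0}` is stable under the normalisation `v ↦ v / vᵢ`.
[folklore] -/
theorem nrm_mem_saturation {i : Fin (p + 1)} {W : Set D.ball} {v : Fin (p + 1) → ℂ}
    (hv : v ∈ {v : Fin (p + 1) → ℂ | ∃ hv : v ∈ D.cone, D.toBall ⟨v, hv⟩ ∈ W ∧ v i ≠ 0}) :
    v i ≠ 0 ∧
      (v i)⁻¹ • v ∈ {v : Fin (p + 1) → ℂ | ∃ hv : v ∈ D.cone, D.toBall ⟨v, hv⟩ ∈ W ∧ v i ≠ 0} := by
  obtain ⟨hv, hvW, hvi⟩ := hv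
  refine ⟨hvi, nrm_mem_cone D hv hvi, ?_, ?_⟩
  · rwa [toBall_mk_smul D (inv_ne_zero hvi) hv]
  · rw [nrm_apply_self hvi]
    exact one_ne_zero

/-- **Injectivity on the slice.** If `ballUnif` is injective on `W ⊆ 𝔹`, then `unif` is injective on
the slice `{v i = 1}` of the saturated cone over `W`: two slice vectors with the same image span lines
of `W` with the same image, hence the same line, and they agree at `i`. [cite: HatcherAT2002, §1.3] -/
theorem injOn_unif_slice (i : Fin (p + 1)) {W : Set D.ball} (hinj : Set.InjOn D.ballUnif W) :
    Set.InjOn D.unif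
      {v ∈ {v : Fin (p + 1) → ℂ | ∃ hv : v ∈ D.cone, D.toBall ⟨v, hv⟩ ∈ W ∧ v i ≠ 0} | v i = 1} := by
  rintro v ⟨⟨hv, hvW, -⟩, hv1⟩ v' ⟨⟨hv', hv'W, -⟩, hv'1⟩ h
  have hb : D.toBall ⟨v, hv⟩ = D.toBall ⟨v', hv'⟩ := hinj hvW hv'W h
  obtain ⟨c, hc⟩ := (D.toBall_eq_toBall_iff _ _).1 hb
  have hc' : (c : ℂ) • v' = v := congrArg Subtype.val hc
  have hci := congrFun hc' i
  rw [Pi.smul_apply, smul_eq_mul, hv1, hv'1, mul_one] at hci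
  rw [← hc', hci, one_smul]

/-- **The sheet.** Under (G1) (`Γ` acts freely and properly discontinuously on the locally compact
Hausdorff ball), `ballUnif : 𝔹 → X(ℂ)` is the quotient covering map of the `Γ`-action, so every point
of the ball has an open neighbourhood meeting each `Γ`-orbit at most once, i.e. on which `ballUnif` is
injective. [cite: HatcherAT2002, §1.3 Prop. 1.40] -/
theorem exists_isOpen_injOn_ballUnif [ProperlyDiscontinuousSMul ↥D.Γ D.ball]
    [IsCancelSMul ↥D.Γ D.ball] [LocallyCompactSpace D.ball] [T2Space D.ball] (b : D.ball) :
    ∃ W : Set D.ball, IsOpen W ∧ b ∈ W ∧ Set.InjOn D.ballUnif W := by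
  have hqc : IsQuotientCoveringMap D.ballUnif ↥D.Γ :=
    D.isOpenQuotientMap_ballUnif.isQuotientMap.isQuotientCoveringMap_of_properlyDiscontinuousSMul
      (G := ↥D.Γ) (fun {x y} ↦ D.ballUnif_eq_iff x y)
  obtain ⟨N, hN, hdisj⟩ := hqc.disjoint b
  obtain ⟨W, hWN, hW, hbW⟩ := mem_nhds_iff.1 hN
  refine ⟨W, hW, hbW, fun x hx y hy hxy ↦ ?_⟩
  obtain ⟨γ, hγ⟩ := MulAction.mem_orbit_iff.1 ((D.ballUnif_eq_iff x y).1 hxy)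
  have h1 : γ = 1 := hdisj γ ⟨x, ⟨y, hWN hy, hγ⟩, hWN hx⟩
  rw [← hγ, h1, one_smul]

/-- **The slice section.** Let `V ⊆ cone` be open, off the hyperplane `{v i = 0}` and stable under
`v ↦ v / vᵢ`, with `unif` injective on the slice `T = {v ∈ V | v i = 1}`. Then `U = unif(T)` is open and
the set-theoretic inverse `σ = (unif|T)⁻¹` (`Function.invFunOn`) is continuous on `U`, with values in
`T` and `unif ∘ σ = id` on `U`: for every open `A`, `U ∩ σ⁻¹(A) = unif(V ∩ nrm⁻¹(A))` is the image of
an open subset of the cone, hence open. [cite: HatcherAT2002, §1.3] -/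
theorem sliceSection_spec (i : Fin (p + 1)) {V : Set (Fin (p + 1) → ℂ)} (hVo : IsOpen V)
    (hVc : V ⊆ D.cone) (hVn : ∀ v ∈ V, v i ≠ 0 ∧ (v i)⁻¹ • v ∈ V)
    (hinjT : Set.InjOn D.unif {v ∈ V | v i = 1}) :
    IsOpen (D.unif '' {v ∈ V | v i = 1}) ∧
      ContinuousOn (Function.invFunOn D.unif {v ∈ V | v i = 1}) (D.unif '' {v ∈ V | v i = 1}) ∧
      ∀ Q ∈ D.unif '' {v ∈ V | v i = 1},
        Function.invFunOn D.unif {v ∈ V | v i = 1} Q ∈ {v ∈ V | v i = 1} ∧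
          D.unif (Function.invFunOn D.unif {v ∈ V | v i = 1} Q) = Q := by
  set T : Set (Fin (p + 1) → ℂ) := {v ∈ V | v i = 1}
  set σ : ComplexPoints X → (Fin (p + 1) → ℂ) := Function.invFunOn D.unif T
  have hσ : ∀ Q ∈ D.unif '' T, σ Q ∈ T ∧ D.unif (σ Q) = Q := fun Q hQ ↦ Function.invFunOn_pos hQ
  -- the key identity: `U ∩ σ⁻¹(A) = unif(V ∩ nrm⁻¹(A))`
  have key : ∀ A : Set (Fin (p + 1) → ℂ),
      D.unif '' T ∩ σ ⁻¹' A = D.unif '' (V ∩ (fun v ↦ (v i)⁻¹ • v) ⁻¹' A) := by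
    intro A
    ext Q
    constructor
    · rintro ⟨hQ, hQA⟩
      obtain ⟨hQT, hQe⟩ := hσ Q hQ
      refine ⟨σ Q, ⟨hQT.1, ?_⟩, hQe⟩
      show ((σ Q) i)⁻¹ • σ Q ∈ A
      rw [nrm_of_apply_eq_one hQT.2]
      exact hQA
    · rintro ⟨v, ⟨hvV, hvA⟩, rfl⟩
      have hnT : (v i)⁻¹ • v ∈ T := ⟨(hVn v hvV).2, nrm_apply_self (hVn v hvV).1⟩
      have hne : D.unif ((v i)⁻¹ • v) = D.unif v := unif_nrm D (hVc hvV) (hVn v hvV).1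
      have hQ : D.unif v ∈ D.unif '' T := ⟨(v i)⁻¹ • v, hnT, hne⟩
      refine ⟨hQ, ?_⟩
      obtain ⟨hQT, hQe⟩ := hσ _ hQ
      have hσv : σ (D.unif v) = (v i)⁻¹ • v := hinjT hQT hnT (hQe.trans hne.symm)
      show σ (D.unif v) ∈ A
      rw [hσv]
      exact hvA
  have hUopen : IsOpen (D.unif '' T) := by
    have h := key Set.univ
    rw [Set.preimage_univ, Set.inter_univ, Set.preimage_univ, Set.inter_univ] at h
    rw [h]
    exact isOpen_image_unif D hVo hVc
  refine ⟨hUopen, ?_, hσ⟩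
  rw [continuousOn_open_iff hUopen]
  intro A hA
  rw [key A]
  exact isOpen_image_unif D
    (((continuousOn_nrm i).mono fun v hv ↦ (hVn v hv).1).isOpen_inter_preimage hVo hA)
    fun v hv ↦ hVc hv.1

end UnifSliceSection

open UnifSliceSection

/-- **Stub A1 (`stub_unifSliceSection`) — local continuous slice sections of `unif` with an injectivity
domain (KNOWN; topology of the covering `𝔹 → Γ \ 𝔹`).** If `Γ` acts freely and properly discontinuously on the
locally compact Hausdorff ball, then `ballUnif : 𝔹 → X(ℂ)` is a covering map
(`IsQuotientMap.isQuotientCoveringMap_of_properlyDiscontinuousSMul`); a local section of it over `U ∋ P`, lifted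
to the cone through the slice `{v | v i = 1}` (`[v] ↦ v / vᵢ` on `{vᵢ ≠ 0}`), is a continuous `σ` with
`unif ∘ σ = id` on `U`; and on the open saturation `V ⊆ cone` of the sheet `s(U)` the map `unif` is injective
on the slice (two slice vectors with the same image span lines in the same sheet, hence the same line).
[cite: HatcherAT2002, §1.3 Prop. 1.40] [cite: BergeronMillsonMoeglin2016Balls, Part 2 §1.4] -/
theorem stub_unifSliceSection :
    ∀ {p : ℕ} {X : SchemeOver ℂ} (D : UnitaryBallQuotientDatum p X)
      [ProperlyDiscontinuousSMul ↥D.Γ D.ball] [IsCancelSMul ↥D.Γ D.ball]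
      [LocallyCompactSpace D.ball] [T2Space D.ball] (P : ComplexPoints X),
      ∃ (U : Set (ComplexPoints X)) (σ : ComplexPoints X → (Fin (p + 1) → ℂ)) (i : Fin (p + 1))
        (V : Set (Fin (p + 1) → ℂ)),
        IsOpen U ∧ P ∈ U ∧ ContinuousOn σ U ∧ IsOpen V ∧ V ⊆ D.cone ∧
          (∀ Q ∈ U, σ Q ∈ V ∧ σ Q i = 1 ∧ D.unif (σ Q) = Q) ∧
          Set.InjOn D.unif {v ∈ V | v i = 1} := by
  intro p X D _ _ _ _ P
  obtain ⟨v₀, hv₀, hP⟩ := D.surjOn_unif (Set.mem_univ P)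
  obtain ⟨W, hW, hbW, hinj⟩ := exists_isOpen_injOn_ballUnif D (D.toBall ⟨v₀, hv₀⟩)
  obtain ⟨i, hi⟩ := exists_apply_ne_zero D hv₀
  set V : Set (Fin (p + 1) → ℂ) :=
    {v : Fin (p + 1) → ℂ | ∃ hv : v ∈ D.cone, D.toBall ⟨v, hv⟩ ∈ W ∧ v i ≠ 0}
  have hVo : IsOpen V := isOpen_saturation D i hW
  have hVc : V ⊆ D.cone := fun v hv ↦ hv.1
  have hVn : ∀ v ∈ V, v i ≠ 0 ∧ (v i)⁻¹ • v ∈ V := fun v hv ↦ nrm_mem_saturation D hv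
  have hinjT : Set.InjOn D.unif {v ∈ V | v i = 1} := injOn_unif_slice D i hinj
  obtain ⟨hUopen, hσc, hσ⟩ := sliceSection_spec D i hVo hVc hVn hinjT
  refine ⟨D.unif '' {v ∈ V | v i = 1}, Function.invFunOn D.unif {v ∈ V | v i = 1}, i, V, hUopen,
    ?_, hσc, hVo, hVc, fun Q hQ ↦ ?_, hinjT⟩
  · refine ⟨(v₀ i)⁻¹ • v₀, ⟨(hVn v₀ ⟨hv₀, hbW, hi⟩).2, nrm_apply_self hi⟩, ?_⟩
    rw [unif_nrm D hv₀ hi, hP]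
  · obtain ⟨hQT, hQe⟩ := hσ Q hQ
    exact ⟨hQT.1, hQT.2, hQe⟩

end Summit.HodgeConjecture.HodgeConjecture.Cruxes.OrthogonalEnveloped.HeckeGraphChow

end
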